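import Summits.AnomalousDissipation.AnomalousDissipation.Theorems.BaireTransferRobustLoudUpgradePeriodicPersistOfHenry
import Summits.AnomalousDissipation.AnomalousDissipation.Theorems.BaireTransferRobustLoudUpgradeStubPeriodicWindow
import Literature.Analysis.FluidPDE.PeriodicNSOrbitPersistsProofs

/-!
# Stub `stub_periodicPersist` of the line `malkin-cone-group-orbits` (crux stmt-AnomalousDissipation-1144,
# `BaireTransfer.RobustLoudUpgrade`): NONDEGENERATE time-periodic loud witnesses are tame, unconditionally

The registered stub `stub_periodicPersist : ∀ S a E ε, nondegPeriodic S a E ε ⊆ persistPeriodic S a E ε`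
(lead's reshape v3: persistence of a nondegenerate time-periodic Navier–Stokes orbit on `T³` under a small change of
the finitely many force coefficients, at fixed viscosity) was reduced in
`…PeriodicPersistOfHenry.lean` (`periodicPersist_of_henry`, p86906) to D. Henry's perturbation theorem
`Literature.Analysis.FluidPDE.PeriodicNSOrbitPersists` (LNM 840, Thm. 8.3.2).  That named fact is now DISCHARGED in
the tree (`Literature.Analysis.FluidPDE.PeriodicNSOrbitPersists_holds`, space–time Fourier-lattice proof,
`Literature/Analysis/FluidPDE/PeriodicNSOrbitPersistsProofs.lean`), so the stub closes by composition, and with the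
landed periodic window (`PeriodicWindow.stub_periodicWindow`, p82010) the class `nondegPeriodic` of the original
skeleton v2 (`stub_periodicIFT`) lies in `interior LOUD` at the same strict budgets: the first genuinely
time-periodic tame witness class of the line outside the laminar corner.  Pure proof file (companion lead c3).
References: Henry 1981, LNM 840, Ch. 8 §8.2–8.3; Iooss 1972, Arch. Rational Mech. Anal. 47, §2–3.
-/

-- `Summit.<Summit>.<Problem>` is the tree's mandated summit-side namespace (CONVENTIONS §2); for this
-- single-conjunct summit the two coincide, so the duplicate is deliberate.
set_option linter.dupNamespace false

noncomputable section

open scoped BigOperators Topology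
open Filter Set Function TopologicalSpace MeasureTheory

namespace Summit.AnomalousDissipation.AnomalousDissipation.Theorems.RobustLoudUpgrade.PeriodicPersist

open Literature.Analysis.FunctionSpaces Literature.Analysis.FunctionSpaces.Torus
open Literature.Analysis.FluidPDE
open Summit.AnomalousDissipation.AnomalousDissipation.Theses.BaireTransfer

/-- **`nondegPeriodic ⊆ interior LOUD`** (the original skeleton's `stub_periodicIFT`, now a theorem): a loud
time-periodic classical witness with simple Floquet multiplier `1` and strict budgets is an interior point of the loud
set — Henry's persistence (discharged) followed by the periodic window. [folklore] -/
theorem nondegPeriodic_subset_interior_loud (S : Finset (Fin 3 → ℤ)) (a E ε : ℝ) :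
    nondegPeriodic S a E ε ⊆ interior (loud S a E ε) :=
  (PeriodicPersistOfHenry.periodicPersist_of_henry PeriodicNSOrbitPersists_holds S a E ε).trans
    (PeriodicWindow.stub_periodicWindow S a E ε)

/-- **Registered stub `stub_periodicPersist`** (lead's reshape v3): `nondegPeriodic ⊆ persistPeriodic` — Henry's
persistence theorem for nondegenerate periodic Navier–Stokes orbits on `T³`, by `periodicPersist_of_henry` and the
discharged fact `PeriodicNSOrbitPersists_holds`. [folklore] -/
theorem stub_periodicPersist : ∀ (S : Finset (Fin 3 → ℤ)) (a E ε : ℝ), nondegPeriodic S a E ε ⊆ persistPeriodic S a E ε :=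
  PeriodicPersistOfHenry.periodicPersist_of_henry PeriodicNSOrbitPersists_holds

end Summit.AnomalousDissipation.AnomalousDissipation.Theorems.RobustLoudUpgrade.PeriodicPersist

end
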